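import Summits.BirchSwinnertonDyer.Rank1Residual.ManinAdditive.ConwayCut
import Summits.BirchSwinnertonDyer.Rank1Residual.ManinAdditive.ConwayNortonTwistAtThree
import HarnessLib
import HarnessLib.Audit.Tags

/-!
# The Katz–Mazur intersection LP at `p = 3`: the edge law at `3` (E-imc-144 `EdgeLawAtThree`) and the `3`-adic
# Atkin–Lehner denominator bound (E-imc-145 `ThreeAdicAtkinLehnerDenominator`) — cell `bsd-f2-manin` (D-0131 (3)
# frontier), lens imc, planner imc g18 MEMO-imc §24 (24.25); typed by the cell typer g14 (T-imc-24, 2026-08-28T18:31:11Z)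
# from HOME/imc/Sketch-imc-g18h.lean sha16 2c8f979efc0a6f31 (farm rc 0 · 0 sorries), VERBATIM except for DEDUP HYGIENE:
# the sketch's local `thirdTranslateGL`, `thirdTranslate N k`, `zeta3` are NOT re-declared — the tree already has
# `RamanujanCut.thirdTranslateGL (j : ℕ)` (`RamanujanCut.lean`), `ConwayNortonThree.thirdTranslate N k (j : ℕ)` and
# `ConwayNortonThree.zeta3` (`ConwayNortonTwistAtThree.lean`) with the same bodies at `j = 1`, so the laws below are
# written with `thirdTranslate N 2 1` and `zeta3` from those namespaces (opened); the two law bodies are otherwise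
# byte-identical to the sketch.  BC5 witness: kit j315087 + j315117, table HOME/imc/kit-g18/g18-kmlp3test-p3.txt
# bbfaa6274762b8b3 (35 levels `9 ∣ N ≤ 387`; E-144 35/35 non-vacuous 33; E-145 35/35 attained at 17), evidence on
# stmt-BirchSwinnertonDyer-22968.  REF1 R-imc-57 (dualising-sheaf shift / cusp ↦ component assignment at 3) PENDING at
# filing.  NOT in print (nearest: Edixhoven's model of `X₀(p²m)` [Edixhoven1991] — shape only).  PARTITION ladder-live
# (C3, E-blind lower-bound side) · beyond-print theorem: no · `3 ∤ c_E` is NOT proved by this; BSD is not proved by this.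

imc g18 text:

HONEST FRAMING.  E-blind statements about `S = S₂(Γ₀(N); ℤ)` at the prime `3`, predicted by the intersection
linear programme of the Katz–Mazur/Edixhoven model of `X₀(3^v m)` over `ℤ₃` (components `C_0,…,C_v`,
multiplicities `φ(3^{min(a,v−a)})`, local equations `x = y^{3^{v−2a}}` [arXiv:2304.12068 p. 8 ← Edixhoven 1990],
rows `Σ_a e_a J_ab < 1 + |J_bb|`, and — on the multiplicity-2 components carrying the cusps `1/3`, `w(1/3)` — the
dualising-sheaf shift `pole_naive = pole_LP + 1`), and CONFIRMED by the standalone `ℤ[ζ₃]`-engine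
`kmlp3test.gp` (kit j315087 + j315117: 35 levels `9 ∣ N ≤ 387`, 0 exceptions; the LP bounds are attained at
`v₃(N) = 2, 3`).  They bear on crux C3 `ManinPrimeToThreeAtNine` (stmt-22968) on the E-blind, lower-bound side
only: `3 ∤ c_E` is NOT proved by this; BSD is not proved by this.  Nothing here is asserted as a theorem: the two
laws are `@[conjecture]` defs.  New vocabulary: `thirdTranslate` (typed exactly like the tree's `halfTranslate`),
`zeta3`, `IsEisensteinIntegral`, `IsThreeIntegral`.
-/

noncomputable section

open scoped MatrixGroups ModularForm
open CongruenceSubgroup Literature.NumberTheory.EllipticCurves.ModularForms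
  Summit.BirchSwinnertonDyer.Rank1Residual.ManinAdditive
  Summit.BirchSwinnertonDyer.Rank1Residual.ManinAdditive.ConwayCut
  Summit.BirchSwinnertonDyer.Rank1Residual.ManinAdditive.ConwayNortonThree

namespace Summit.BirchSwinnertonDyer.Rank1Residual.ManinAdditive.NeronCuspThree

/-! `t₃ = ConwayNortonThree.thirdTranslate N k 1` (`f ↦ f(z + ⅓)`, `aₙ ↦ ζ₃ⁿ aₙ`; `9^{1−k/2}` times the double-coset
operator of `RamanujanCut.thirdTranslateGL 1 = (3 1; 0 3)`) and `ζ₃ = ConwayNortonThree.zeta3 = exp(2πi/3)` are the TREE's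
(landed in `ConwayNortonTwistAtThree.lean` / `RamanujanCut.lean`); the sketch's identical local copies are not re-declared. -/

variable (N : ℕ) [NeZero N]

/-- `x ∈ S ⊗ ℤ[ζ₃]`: `x = y + ζ₃ z` with `y, z ∈ S₂(Γ₀(N); ℤ)` (q-expansion `ℤ[ζ₃]`-integral at `∞`). -/
def IsEisensteinIntegral (x : CuspForm (Gamma0 N) 2) : Prop :=
  ∃ y ∈ integralCuspForms0 N 2, ∃ z ∈ integralCuspForms0 N 2, x = y + zeta3 • z

/-- `x` is `3`-adically integral at `∞`: some prime-to-`3` multiple of `x` lies in `S₂(Γ₀(N); ℤ)`. -/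
def IsThreeIntegral (x : CuspForm (Gamma0 N) 2) : Prop :=
  ∃ m : ℕ, ¬ 3 ∣ m ∧ (m : ℂ) • x ∈ integralCuspForms0 N 2

/-- LAW E-imc-144 `EdgeLawAtThree` (imc g18; conjecture = the value-0 vertex of the Katz–Mazur LP at 3): for `9 ∣ N`
and an integral cusp form `x`, if `x` is `3`-adically `ℤ[ζ₃]`-integral at the cusp `1/3` (i.e. a prime-to-3 multiple
of `w(t₃ x)`, `w = w_{3^{v₃(N)}}`, is `ℤ[ζ₃]`-integral), then `x` is `3`-adically integral at the cusp `0` (`w x`).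
(`t₃ x` is spelled `thirdTranslate N 2 1 x` with the tree's `ConwayNortonThree.thirdTranslate`.)
kmlp3test.gp field `oA = 0`: 35/35 levels `9 ∣ N ≤ 387`, non-vacuous at 33.  Why it might fail: the dictionary
(dualising-sheaf shift on the multiplicity-2 component); levels beyond 450.
TYPER FRAMING: lens imc; E-BLIND LAW, nothing asserted; BC5 35/35 (`9 ∣ N ≤ 387`, non-vacuous 33, kmlp3test bbfaa6274762b8b3);
REF1 R-imc-57 PENDING; NOT in print.  OPEN.
[cite: Edixhoven1991, §1 (shape only: components and local equations of `X₀(N)` at `3² ∣ N`; the edge law at 3 is the cell's E-imc-144 — imc MEMO-imc §24 (24.25))] -/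
@[conjecture] def EdgeLawAtThree : Prop :=
  ∀ (N : ℕ) [NeZero N], 9 ∣ N → ∀ x ∈ integralCuspForms0 N 2,
    (∃ m : ℕ, ¬ 3 ∣ m ∧
      IsEisensteinIntegral N ((m : ℂ) • atkinLehnerInvolutionAt N 2 3 (thirdTranslate N 2 1 x))) →
    IsThreeIntegral N (atkinLehnerInvolutionAt N 2 3 x)

/-- LAW E-imc-145 `ThreeAdicAtkinLehnerDenominator` (imc g18; conjecture = the single-cusp value `v` of the
Katz–Mazur LP at 3): for `3 ∣ N` and every integral cusp form `x`, `3^{v₃(N)} · w_{3^{v₃(N)}} x` is `3`-adically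
integral.  kmlp3test.gp field `e0 ≤ v`: 35/35 levels (`9 ∣ N ≤ 387`), attained at 17 of them; the `v = 1` case
(`3 ∥ N`, bound `3`) is the LP row `n < 2` and is untested here.
TYPER FRAMING: lens imc; E-BLIND universal denominator bound; BC5 35/35 (attained at 17/35); REF1 R-imc-57 PENDING; NOT in
print.  OPEN.
[cite: Edixhoven1991, §1 (shape only; the `3`-adic Atkin–Lehner denominator bound is the cell's E-imc-145 — imc MEMO-imc §24 (24.25))] -/
@[conjecture] def ThreeAdicAtkinLehnerDenominator : Prop :=
  ∀ (N : ℕ) [NeZero N], 3 ∣ N → ∀ x ∈ integralCuspForms0 N 2,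
    IsThreeIntegral N (((3 : ℂ) ^ (padicValNat 3 N)) • atkinLehnerInvolutionAt N 2 3 x)

end Summit.BirchSwinnertonDyer.Rank1Residual.ManinAdditive.NeronCuspThree
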